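import Summits.HodgeConjecture.HodgeConjecture.Theses.PadicSemiregularLift
import Summits.HodgeConjecture.HodgeConjecture.Theses.TropicalCuspLift
import Summits.HodgeConjecture.HodgeConjecture.Theorems.HodgeAbelianVarieties.Negative.ExtremeCodimensions
import Summits.HodgeConjecture.HodgeConjecture.Theorems.PadicSemiregularLiftHodgeAbelianVarietiesEStepDefs
import Literature.AlgebraicGeometry.HodgeTheory.WeilClasses
import Literature.AlgebraicGeometry.Motives.AbelianVarietyProduct

/-!
# Skeleton line `tannakian-odd-charge-witness` for crux `HodgeAbelianVarieties` (stmt-HodgeConjecture-1333) — gen 2 (crux-strategist, 2026-08-17; gen 2 = Weil-type guard on stub 1)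

Route `PadicSemiregularLift`, crux r4 `HodgeAbelianVarieties := ∀ A : AbelianVariety ℂ, HodgeConjectureFor A.dim A.X`
(= the summit restricted to abelian varieties, `Negative.iff_hodgeConjecture_restricted`, p70486, IMPORTED).

## Why this line exists (wall-breaker census, `STRATEGY-CENSUS.md` on the crux)

All five registered lines of the chain were TRANSPORT lines: produce a representative of the Weil class
at a SPECIAL member of a Weil / Mumford–Tate family and spread it by an infinitesimal lever. Each died on
a theorem at its first calibration (p-adic engine image HC-equivalent at supersingular anchors; Markman's
criterion needs `G`-rigid seeds; `{0,1}`-semiregularity sees only `ℂ[θ]`; lci galleries fail by isotropy;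
Schoen's Prym 4-fold is not an lci embedding). This line is the ONE surviving crux idea of round 2 that is
NOT a transport line and was never triaged (`Ideas/tannakian-charge-dichotomy.md`, ideator 5; the round-2
triage panel was handed only the Prym card): EXISTENCE BY RECONSTRUCTION AT THE GENERIC MEMBER.

## The lever (crux idea `tannakian-charge-dichotomy`, sharpened)

For a polarized abelian `2n`-fold `(A, φ)` of Weil type, `K = ℚ(√-d)`, Lieberman 1968 (hom = num on
complex abelian varieties) + Jannsen 1992 make the ⊗-category generated by `h¹(A)` in homological motives
with ALGEBRAIC correspondences semisimple Tannakian; its group `G_alg(A)` satisfies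
`MT(A) ⊆ G_alg(A) ⊆ L(A)·𝔾_m` (Milne 1999 Def. 4.3 / Thm 4.4: `L(A)` = stabiliser of the Lefschetz
classes on all powers = centraliser of `End⁰`), and `Alg^p(A^k) = H^{2p}(A^k)^{G_alg(A)}` EXACTLY. For
Weil-GENERIC `A` (`MT = 𝔾_m·SU(φ)`), `L°/MT° = U(φ)/SU(φ) = U(1)_K` is a rank-one ANISOTROPIC torus, whose
only algebraic subgroups are `U(1)_K[m]` and itself. HENCE (the dichotomy, paper-level theorem,
`BarrierNotesIdeator4Round2.md` §B2): `G_alg(A)` is the preimage of `U(1)_K[m(A)]` for ONE integer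
`m(A) ∈ ℕ_{≥1} ∪ {∞}`, and the algebraic classes on EVERY power `A^k` are exactly the Hodge classes all of
whose `U(1)_K`-charges are `≡ 0 mod m(A)` (charge of `⋀ᵃV_σ ⊗ ⋀ᵇV_σ̄` = `a − b`). The Weil plane has
charge `±2n`. So: ONE algebraic class on `A × A` (any codimension) with a non-zero component of charge
EXACTLY `±2n` forces `m(A) ∣ 2n`, hence `W_K(A) ⊆ Alg` — the cycle representing the Weil class EXISTS by
Tannaka duality and is never written down. From the Weil-generic member algebraicity specialises to the
whole component (algebraicity locus = countable union of Zariski-closed sets, the tree's THEOREM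
`charlesSchnell_algebraicityLocus_iUnion_closed_holds`, + Baire), so a witness at EVERY `(A, φ)` (in
particular at the Weil-generic ones) gives the whole imaginary-quadratic Weil sector, all `n ≥ 2`, all
discriminants — no descending, no eightfolds, no seeds, no semiregularity.

WHY THE TRANSFER IS EASIER although equivalent to the sector (HC ⟹ `pr₁^* w` is a witness): the unknown
changes TYPE — from "represent ONE prescribed middle-dimensional class on `A`" to "the algebra `Alg(A^•)` is
not `U(1)_K`-symmetric", decided by a single ASYMMETRIC SPECIMEN of any shape: an excess-dimensional
component of a theta-multiplicity locus, the pull-back of a ruling of a quadric containing the Kummer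
image `K(A) ⊂ |2Θ|^*` (van Geemen's `ℚ(i)`-fourfold trick, LNM 1594 §7.5, one level up), a Chern class of a
moduli correspondence of stable sheaves on `A` — each testable by a FINITE charge computation (the
blind-spot lemmas of the card: `φ`-stable irreducible cycles are charge-blind in odd `n`,
`IdeatorFive.weil_component_eq_zero_of_pos_eigen`, PROVED; single-eigenspace theta maps factor through
`A/[i]`, BarrierNotes B1(b); squares/`K`-linear correspondences have even charge, B2(C2)).

## Shape: three registered stubs, composition by pure logic

* `stub_oddChargeWitness : OddChargeWitness` — THE BET (open, XL; a SEARCH with kit-able supplies): for every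
  `n ≥ 2`, `d > 0` and every `(A, φ)` with `dim A = 2n`, `φ² = -d`, some algebraic class on `A × A` (diagonal
  `K`-action `Φ = φ × φ`) in some degree `2k` lies OUTSIDE the span of the `Φ`-eigenclasses of charge
  `≠ ±2n` (`offWeilChargeClasses`), i.e. has a non-zero charge-`±2n` component.
* `stub_tannakianAmplification : OddChargeWitness → ∀ n d, 2 ≤ n → 0 < d → WeilAlgebraicAll n d` — the
  DICHOTOMY + specialisation from the Weil-generic member (paper-level theorem from Lieberman 1968, Jannsen
  1992, Deligne–Milne LNM 900, Milne 1999 Thm 4.4/Ex. 4.10/Cor. 5.8, + the tree's algebraicity-locus theorem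
  and Baire; Lean-far: no numerical motives / algebraic groups over `ℚ` in the tree).
* `stub_weilSectorSuffices : WeilSectorSuffices` — PARKED COMPLEMENT, byte-identical with the e-step / Prym
  registered stub (shared item; partials p97654/p119954: `= HodgeAbelianVarieties ∨ ¬WeilClassesAlgebraic`;
  its open content is child 1 + child 3 of the CM PIVOT, `Lines/cm_pivot.lean`).

PROVED glue: `weilClassesAlgebraic_of` (the sector statement `TropicalCuspLift.WeilClassesAlgebraic`,
stmt-2522, from stubs 1–2; dictionary `mem_weilClassesOf_iff`), `weilSixfolds_of` (stmt-2524),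
`HodgeAbelianVarieties_of_stubs`, and `HodgeAbelianVarieties_of` (the crux BY NAME, fed with the sorried stubs).

## Disproof used (`Disproof.lean` v4, cycles 1–4, NO KILL; `## Targets`: nothing on Tannakian witnesses)
* §1 `iff_hodgeConjecture_restricted`: the line attacks the Weil sector below the crux and names its
  complement edge (`stub_weilSectorSuffices`).  §3 `weilItems_of` / `hodgeAbelianVarieties_iff_deepMiddle`:
  witnesses live in codimension `≥ n` on `A × A` — consistent with the deep-middle localisation (the card
  widens the ambient to powers, which §3 does not exclude).  §4 `_false_without_proper` /
  `_false_without_groupLaw`: USED — `L(A)`, Rosati, Lieberman need the polarisation and the group law;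
  `not_integralSaturationOnAbelianVarieties`: ℚ-linear throughout.  §5 `kaehler_analogue_fails`: for
  Voisin's Weil tori there is no `G_alg` (classes not analytic) — the dichotomy is void there, correctly.
  §8 `not_hodgeRingDivisorGeneratedOnAbelianVarieties` (`Bᵖ = Dᵖ` refuted, Weil 1977 / Mumford 1968): that
  strengthening IS branch `m(A) = ∞` restricted to `A`; the line must EXCLUDE it and never asserts it.
  §11 F14–16 / `Negative/StubWeilSectorSeedsFalseOf`: irrelevant (no seeds are deformed); a WARNING only for
  sheaf-moduli supplies.  `Negative/InnerFormSeedsTyping`, `KillTransfer`: not touched / accepted (a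
  refutation of `TropicalCuspLift.WeilClassesAlgebraic` kills this line too, `weilClassesAlgebraic_of`).
* `ledger negatives --problem HodgeConjecture` (Fermat multisets, E-line): no contact.
-/

set_option linter.dupNamespace false

noncomputable section

open CategoryTheory
open Literature.AlgebraicGeometry Literature.AlgebraicGeometry.Motives
  Literature.AlgebraicGeometry.HodgeTheory Literature.AlgebraicTopology.SingularHomology

namespace Summit.HodgeConjecture.HodgeConjecture.Cruxes.HodgeAbelianVarieties.TannakianOddChargeWitness

open Summit.HodgeConjecture.HodgeConjecture.Cruxes.HodgeAbelianVarieties.EStepSecantInduction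

/-! ### Vocabulary (local to the line; class level, REAL carriers) -/

/-- The diagonal `K`-action `Φ = φ × φ` on `A × A` (ideator 5's `PhiSq`, same text). -/
def PhiSq (A : AbelianVariety ℂ) (φ : A ⟶ A) : A.prod A ⟶ A.prod A :=
  AbelianVariety.prodLift (AbelianVariety.fst A A ≫ φ) (AbelianVariety.snd A A ≫ φ)

/-- **The `Φ`-eigenclasses of `H^k((A × A)(ℂ); ℂ)` of `U(1)_K`-charge `≠ ±2n`**: the span of the joint
eigenclasses `c` with `(x·𝟙 + y·Φ)^* c = (x + i y √d)^a (x − i y √d)^{k−a} · c` for all `x y : ℕ`, over all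
`a ≤ k` with `a − (k − a) ∉ {2n, −2n}` (on `⋀ᵃ(V_σ ⊕ V_σ) ⊗ ⋀^{k−a}(V_σ̄ ⊕ V_σ̄)` the torus `U(1)_K ∋ u` acts by
`u^{a−(k−a)}`; `Φ^*` is semisimple with these eigenvalues, so the pieces over ALL `a` span `H^k`, and a class
lies outside this submodule iff its charge-`±2n` component is non-zero). [cite: vanGeemen1994HodgeAV, 4.8–4.9 (eigen-decomposition under `x + yφ`)] -/
def offWeilChargeClasses (A : AbelianVariety ℂ) (φ : A ⟶ A) (k d n : ℕ) :
    Submodule ℂ (complexBetti (A.prod A).X k) :=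
  ⨆ (a : ℕ) (_ : a ≤ k ∧ (2 * (a : ℤ) - k ≠ 2 * n ∧ 2 * (a : ℤ) - k ≠ -(2 * (n : ℤ)))),
    pullbackEigenclasses (A.prod A) (PhiSq A φ) k
      (fun x y => ((x : ℂ) + (y : ℂ) * Complex.I * (Real.sqrt d : ℂ)) ^ a *
        ((x : ℂ) - (y : ℂ) * Complex.I * (Real.sqrt d : ℂ)) ^ (k - a))

/-- **An odd-charge witness for `(A, φ)` in half-dimension `n`**: an ALGEBRAIC class on `A × A`, in some
codimension `k`, with a non-zero component of `U(1)_K`-charge exactly `±2n` (= outside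
`offWeilChargeClasses`). Any shape is allowed (excess theta-multiplicity loci, pulled-back quadric rulings
through the Kummer image, Chern classes of moduli correspondences, `pr₁^*` of a cycle on `A`, …). -/
def OddChargeWitnessFor (n d : ℕ) (A : AbelianVariety ℂ) (φ : A ⟶ A) : Prop :=
  ∃ (k : ℕ) (c : complexBetti (A.prod A).X (2 * k)),
    c ∈ algebraicClasses (A.prod A).X k ∧ c ∉ offWeilChargeClasses A φ (2 * k) d n

/-- **STUB 1's statement**: odd-charge witnesses exist on every pair `(A, φ)`, `dim A = 2n`, `φ² = -d`, WHOSE WEIL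
PLANE CARRIES A NON-ZERO RATIONAL `(n,n)`-CLASS (the guard = "of Weil type": for `K`-signature `(p, q) ≠ (n, n)` every
Hodge class on `A × A` has charge `0` — type `(a, b)` pieces have charge `a − b` — so no witness could exist there, while
nothing is to be proved there either; gen 2 of the skeleton, strategist self-critique), all `n ≥ 2`, all `d > 0`. -/
def OddChargeWitness : Prop :=
  ∀ (n d : ℕ), 2 ≤ n → 0 < d → ∀ (A : AbelianVariety ℂ) (φ : A ⟶ A),
    A.dim = 2 * n → φ ≫ φ = -(d • 𝟙 A) →
    (∃ w ∈ weilClassesOf A φ n d, w ≠ 0 ∧ IsRationalClass w ∧ IsOfHodgeType (2 * n) A.X (2 * n) n n w) →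
    OddChargeWitnessFor n d A φ

/-- **STUB 2's statement**: the Tannakian amplification — witnesses everywhere give the whole imaginary-quadratic
Weil sector (`WeilAlgebraicAll n d`, the e-step line's landed class-level predicate, all discriminants). -/
def TannakianAmplification : Prop :=
  OddChargeWitness → ∀ n d : ℕ, 2 ≤ n → 0 < d → WeilAlgebraicAll n d

/-- **STUB 3's statement** (byte-identical with the e-step / Prym registered stub, shared item): the
imaginary-quadratic Weil sector (`TropicalCuspLift.WeilClassesAlgebraic`, stmt-HodgeConjecture-2522) implies the crux. -/
def WeilSectorSuffices : Prop :=
  Summit.HodgeConjecture.HodgeConjecture.Theses.TropicalCuspLift.WeilClassesAlgebraic →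
    Summit.HodgeConjecture.HodgeConjecture.Theses.PadicSemiregularLift.HodgeAbelianVarieties

/-! ### The three registered stubs -/

/-- STUB 1 (XL, OPEN — THE BET; a SEARCH, not a construction of the Weil cycle) — **odd-charge witnesses
exist**: `OddChargeWitness`. Why plausibly true: HC implies it trivially (`pr₁^* w`), and far more cheaply
any asymmetric specimen does; supplies with finite tests (card §Cheapest falsifier, in this order): (S2)
quadrics containing the Kummer image `K(A) ⊂ ℙ^{2^{2n}−1}` of a Weil-type `A` and their maximal linear
subspaces pulled back to `A` and pushed to `A × A` — CALIBRATED at `g = 4` (kit j014045: exactly 6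
independent quadrics on van Geemen's `ℚ(i)` fourfold family, a rank-6 member = his smooth quadric on
`ℙH⁰₋`, none on the generic control), UNDECIDED at `g = 6` (jobs j013647 / j013651 / j014052 TIMED OUT at
0.5 / 2 / 3 h — first task of the lead: re-batch with certified theta-nulls and a rank-revealing solver on the
pool); by BarrierNotes B1(b) only `[i]`-ANTI-invariant combinations of rulings can carry charge `±6` for
`ℚ(i)` sixfolds; (S1) excess-dimensional components of theta-multiplicity loci `Sing_kΘ` on Weil-type
members (expected-dimensional ones have Porteous classes in `ℚ[θ]`, charge 0): decide `dim Sing Θ` at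
Kani-glued CM points of the `ℚ(√-3)` sixfold Hecke orbit by certified theta-null vanishing; (S3) Chern
classes of moduli correspondences of stable sheaves with Lefschetz Mukai vector. Why it might fail: a
HIDDEN-EQUIVARIANCE theorem — "every algebraic class any of S1–S3 produces on a Weil-generic `A × A` is
`U(1)_K`-invariant for structural reasons" — would empty all supplies at once (none is known; Markman's
reflexive secant sheaves show S3 is not empty on split sixfolds). BLIND SPOTS (proved / recorded, do not
search there): `φ`-stable irreducible cycles in odd `n` (`IdeatorFive.weil_component_eq_zero_of_pos_eigen`),
single-eigenspace theta maps (B1(b)), squares and `K`-(anti)linear self-correspondences (even charge, B2(C2)).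
Honours Disproof §4 (proper + group law used), §8 (branch `m = ∞` is what must be excluded). Sources:
Milne1999LefschetzClasses Thm 4.4, Ex. 4.10, Prop. 5.7; vanGeemen1994HodgeAV §7.5 (theta quadric trick);
vanGeemen1996ThetaCycles (Math. Z. 221); Weil1977HodgeRing; arXiv:2603.20268 pp. 1–3 (frontier). -/
theorem stub_oddChargeWitness : OddChargeWitness := by
  sorry

/-- STUB 2 (L–XL to FORMALISE, TRUE ON PAPER — the DICHOTOMY and the specialisation) — **Tannakian amplification**:
`OddChargeWitness → ∀ n d, 2 ≤ n → 0 < d → WeilAlgebraicAll n d`. Paper proof (BarrierNotesIdeator4Round2 §B2 +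
card §Lever): fix `(n, d)` and a Weil-type `(A, φ)`; its polarised Weil Shimura component `S` has Weil-generic
very general members `A_η` (complement of countably many proper special subvarieties); the witness at `A_η`
is an algebraic, hence `G_alg(A_η)`-invariant, class with a non-zero charge-`±2n` component, so
`G_alg(A_η)° = MT°` and the finite central part `U(1)_K[m]` fixes that component, `m ∣ 2n`, whence it acts
trivially on the Weil plane (charge `±2n`): `W_K(A_η) ⊆ H^{2n}(A_η)^{G_alg} = Alg^n(A_η)` (Tannaka duality in
`⟨h¹(A_η)⟩_{hom}`: Lieberman hom = num, Jannsen semisimplicity, Künneth projectors Lefschetz (Milne Cor. 5.8),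
Betti fibre functor; `MT ⊆ G_alg ⊆ L·𝔾_m`, Milne Def. 4.3/Thm 4.4/Ex. 4.10; rank-one anisotropic quotient).
Then the algebraicity locus of the flat Weil sections over `S` — a countable union of Zariski-closed subsets
(tree THEOREM `charlesSchnell_algebraicityLocus_iUnion_closed_holds`) — contains every Weil-generic point,
hence (Baire on `S(ℂ)`) has a component equal to `S`, hence contains `(A, φ)`. Rationality / `(n,n)`-type of
the target class are hypotheses of `WeilAlgebraicFor`; where the guard of stub 1 fails (no non-zero rational `(n,n)` Weil
class) `WeilAlgebraicFor` holds trivially (`0 ∈ algebraicClasses`), so witnesses are needed only where stub 1 supplies them. Why it might fail (as a TYPED statement): only through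
a typing artefact of `offWeilChargeClasses` at degenerate `(A, φ)` (e.g. `φ² = -d` with `dim A ≠ 2n` is
excluded by the binders; `k` with `2k < 2n` gives `offWeilChargeClasses = ⊤`, so no witness there — fine);
mathematically it is a theorem. Lean-far: no numerical motives, no linear algebraic groups over `ℚ`, no
Chevalley theorem in the tree. Sources: Lieberman1968 (Amer. J. Math. 90); Jannsen1992 (Invent. 107);
DeligneMilne1982Tannakian (LNM 900 II, Prop. 3.1(c)); Milne1999LefschetzClasses (Duke 96) Def 4.3, Thm 4.4,
Ex 4.10, Cor 5.8; Andre1996Motivated (for comparison: `G_mot = MT` on abelian varieties). -/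
theorem stub_tannakianAmplification : TannakianAmplification := by
  sorry

/-- STUB 3 (XXL, OPEN — PARKED COMPLEMENT, NOT attacked by this line; byte-identical with the e-step gen-3 /
Prym gen-4 registered stub, shared item; partials p97654 / p119954) — the imaginary-quadratic Weil sector
implies the crux. Its open content is EXACTLY children 1 and 3 of the CM PIVOT (`Lines/cm_pivot.lean`:
HC for CM abelian varieties — Weil classes relative to CM fields of degree `> 2`, André 1992 — and local VHC
at CM fibres for the non-Weil non-CM sector, Mumford-type families included); `= HodgeAbelianVarieties ∨
¬WeilClassesAlgebraic` (`weilSectorSuffices_iff`, p97654). Sources: Andre1992CMHodge; MoonenZarhin1999;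
Markman2025SurveySecant Thm 1.4; Deligne1982HodgeCycles. -/
theorem stub_weilSectorSuffices : WeilSectorSuffices := by
  sorry

/-! ### Name-keyed aliases of the stub statements -/
namespace Registered

/-- Alias of `OddChargeWitness` keyed by the registered stub name. -/
abbrev stub_oddChargeWitness : Prop := OddChargeWitness
/-- Alias of `TannakianAmplification` keyed by the registered stub name. -/
abbrev stub_tannakianAmplification : Prop := TannakianAmplification
/-- Alias of `WeilSectorSuffices` keyed by the registered stub name. -/
abbrev stub_weilSectorSuffices : Prop := WeilSectorSuffices

end Registered

/-! ### Glue (proved, no `sorry`) -/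

/-- **STUBS 1 + 2 close the tree's typed Weil target** `TropicalCuspLift.WeilClassesAlgebraic`
(stmt-HodgeConjecture-2522; dictionary `mem_weilClassesOf_iff`). -/
theorem weilClassesAlgebraic_of (h₁ : OddChargeWitness) (h₂ : TannakianAmplification) :
    Summit.HodgeConjecture.HodgeConjecture.Theses.TropicalCuspLift.WeilClassesAlgebraic := by
  intro n hn d hd A φ hA _hX hφ c hc hH hw
  exact h₂ h₁ n d hn hd A φ hA hφ c (mem_weilClassesOf_iff.2 hw) hc hH

/-- **First frontier instance in the tree's terms**: `TropicalCuspLift.WeilSixfolds` (stmt-HodgeConjecture-2524: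
Weil classes on abelian sixfolds of EVERY discriminant — "completely open" off the split components,
arXiv:2603.20268 p. 3) from stubs 1 + 2 at `n = 3`. -/
theorem weilSixfolds_of (h₁ : OddChargeWitness) (h₂ : TannakianAmplification) :
    Summit.HodgeConjecture.HodgeConjecture.Theses.TropicalCuspLift.WeilSixfolds := by
  intro d hd A φ hA _hX hφ c hc hH hw
  exact h₂ h₁ 3 d (by norm_num) hd A φ hA hφ c (mem_weilClassesOf_iff.2 hw) hc hH

/-! ### The composition: the stubs imply the crux, by name -/

/-- **The crux from the stub STATEMENTS** (pure logic): stubs 1 + 2 give the imaginary-quadratic Weil sector,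
stub 3 is the parked edge to the crux. -/
theorem HodgeAbelianVarieties_of_stubs (h₁ : Registered.stub_oddChargeWitness)
    (h₂ : Registered.stub_tannakianAmplification) (h₃ : Registered.stub_weilSectorSuffices) :
    Summit.HodgeConjecture.HodgeConjecture.Theses.PadicSemiregularLift.HodgeAbelianVarieties :=
  h₃ (weilClassesAlgebraic_of h₁ h₂)

/-- **`HodgeAbelianVarieties_of` — the crux BY NAME from the three registered stubs** (hypothesis-free form
fed with the sorried stubs; its own term contains no `sorry`; the only theorem of the file whose conclusion
head is the crux decl besides `…_of_stubs`). -/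
theorem HodgeAbelianVarieties_of :
    Summit.HodgeConjecture.HodgeConjecture.Theses.PadicSemiregularLift.HodgeAbelianVarieties :=
  HodgeAbelianVarieties_of_stubs stub_oddChargeWitness stub_tannakianAmplification stub_weilSectorSuffices

/-! ### Sanity -/

/-- Consistency with the landed Negative lemma (p70486): what the skeleton proves is literally the summit
restricted to abelian varieties. -/
example (h₁ : OddChargeWitness) (h₂ : TannakianAmplification) (h₃ : WeilSectorSuffices) :
    ∀ A : AbelianVariety ℂ, IsSmoothProjective A.dim A.X → HodgeConjectureFor A.dim A.X :=
  Summit.HodgeConjecture.HodgeConjecture.Theorems.HodgeAbelianVarieties.Negative.iff_hodgeConjecture_restricted.1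
    (HodgeAbelianVarieties_of_stubs h₁ h₂ h₃)

/-- Upper bound (no stub on the Weil side claims more than the summit): the sector statement follows from
the crux. -/
example (h : Summit.HodgeConjecture.HodgeConjecture.Theses.PadicSemiregularLift.HodgeAbelianVarieties)
    {n d : ℕ} : WeilAlgebraicAll n d := by
  intro A φ hA _ c _ hc hH
  have h2 := (h A).2 n c
  rw [hA] at h2
  exact h2 hc hH

/-- Typing sanity for `offWeilChargeClasses`: in degree `2k` with `2k < 2n` NO charge reaches `±2n`, so
every index `a ≤ 2k` is admitted and the zero class is (trivially) inside — witnesses must live in degree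
`2k ≥ 2n`, as the lever says (codimension `≥ n`). -/
example (A : AbelianVariety ℂ) (φ : A ⟶ A) (k d n : ℕ) :
    (0 : complexBetti (A.prod A).X k) ∈ offWeilChargeClasses A φ k d n :=
  Submodule.zero_mem _

end Summit.HodgeConjecture.HodgeConjecture.Cruxes.HodgeAbelianVarieties.TannakianOddChargeWitness

end
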